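import Mathlib
import Literature.MathematicalPhysics.QuantumFieldTheory.MirrorRPKernel
import Literature.MathematicalPhysics.QuantumFieldTheory.PointwiseOSReconstruction
import HarnessLib

/-!
# Half-space clusters of a hyperplane mirror and the Osterwalder–Schrader kernel of a correlation family

Topic `Literature/MathematicalPhysics/QuantumFieldTheory`.  The pointwise Osterwalder–Schrader data
of a correlation family `S : CorrFamily d` (`S n : (Fin n → ℝ^d) → ℝ`) with respect to an ARBITRARY
hyperplane mirror `n^⊥` through the origin (normal `n : ℝ^d`, reflection
`θ_n = ((ℝ ∙ n)ᗮ).reflection`, Mathlib): the sibling file `PointwiseOSReconstruction.lean` does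
this for a coordinate axis and injective clusters; the critical-Ising rotation programme
(route CriticalPhenomena/…/HyperoctahedralRP, in-plane light cone) needs the nine lattice mirrors
`e_i`, `e_i ± e_j` of `ℤ³` and clusters with repetitions allowed.

* `HalfSpaceCluster d n` — finitely many points of the open half-space `{⟪x, n⟫ > 0}` (no
  injectivity; the empty cluster is the vacuum); translations `translate v` (`⟪v, n⟫ ≥ 0`) and the
  two-parameter shifts `shift n' t s = translate (s n' + (t ∨ 0) n)` along a mirror direction
  `n' ⊥ n` and the normal.
* `mirrorKernel S n a b = S (θ_n a ⊔ b)` (Glimm–Jaffe (6.1.9) / Osterwalder–Schrader (4.3) in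
  pointwise form) and its geometry: symmetry from `θ_n`-invariance and permutation symmetry
  (`mirrorKernel_comm`), `K(a + t n, b) = K(a, b + t n)` (`mirrorKernel_translate_normal`) and
  `K(a + v, b + v) = K(a, b)` for `v ⊥ n` (`mirrorKernel_translate_orth`) from translation invariance.
* `MirrorOSData S n` — the hypotheses of the kernel-level OS reconstruction in the frame `n`:
  reflection positivity over clusters (Osterwalder–Schrader (E2) / Glimm–Jaffe (6.1.8)–(6.1.11),
  real coefficients), `θ_n`- and permutation invariance, translation invariance, bounded and
  continuous kernel entries under shifts; and its first consequences: positivity of the real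
  quadratic form over finite sets (`sum_sum_nonneg`) and of the complex Hermitian form over finitely
  supported complex functionals (`re_sum_sum_conj_nonneg`).

The Hilbert space, `e^{-tH}`, `e^{isP}` and the joint spectral measures are in
`MirrorClusterOSSpace.lean`.  NOT here: any specific `S`, lattice normals, light cones.

## References
* K. Osterwalder, R. Schrader, *Axioms for Euclidean Green's functions*, Comm. Math. Phys. 31
  (1973), §4.1 (4.3)–(4.7). [folklore]
* J. Glimm, A. Jaffe, *Quantum Physics* (2nd ed. 1987), §6.1 (6.1.8)–(6.1.12). [folklore]
-/

noncomputable section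

open scoped InnerProductSpace BigOperators ComplexConjugate
open Literature.Probability.LatticeModels Finset

namespace Literature.MathematicalPhysics.QuantumFieldTheory

variable {d : ℕ}

/-! ### Half-space clusters -/

/-- A **half-space cluster** for the mirror with normal `n`: finitely many points of `ℝ^d` in the
open half-space `{⟪x, n⟫ > 0}` (repetitions allowed; the empty cluster indexes the vacuum).  The
pointwise stand-in for a positive-time test function of Osterwalder–Schrader §4.1 /
Glimm–Jaffe §6.1 (`𝒜₊`). [folklore] -/
structure HalfSpaceCluster (d : ℕ) (n : EuclideanSpace ℝ (Fin d)) where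
  /-- the number of points -/
  k : ℕ
  /-- the points -/
  pts : Fin k → EuclideanSpace ℝ (Fin d)
  /-- the points lie in the open half-space `{⟪x, n⟫ > 0}` -/
  pos : ∀ i, 0 < ⟪pts i, n⟫_ℝ

namespace HalfSpaceCluster

variable {n : EuclideanSpace ℝ (Fin d)}

/-- Two clusters with the same points (as a dependent pair) are equal. [folklore] -/
protected theorem ext' {a b : HalfSpaceCluster d n}
    (h : (⟨a.k, a.pts⟩ : Σ k, Fin k → EuclideanSpace ℝ (Fin d)) = ⟨b.k, b.pts⟩) : a = b := by
  obtain ⟨k, p, _⟩ := a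
  obtain ⟨k', p', _⟩ := b
  cases h
  rfl

/-- Translation of a cluster by a vector `v` with `⟪v, n⟫ ≥ 0` (stays in the half-space). [folklore] -/
def translate (v : EuclideanSpace ℝ (Fin d)) (hv : 0 ≤ ⟪v, n⟫_ℝ) (a : HalfSpaceCluster d n) :
    HalfSpaceCluster d n where
  k := a.k
  pts := fun i => a.pts i + v
  pos := fun i => by rw [inner_add_left]; linarith [a.pos i]

/-- A translation keeps the number of points. [folklore] -/
@[simp] theorem translate_k (v : EuclideanSpace ℝ (Fin d)) (hv : 0 ≤ ⟪v, n⟫_ℝ) (a : HalfSpaceCluster d n) :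
    (a.translate v hv).k = a.k := rfl

/-- The points of a translated cluster. [folklore] -/
@[simp] theorem translate_pts (v : EuclideanSpace ℝ (Fin d)) (hv : 0 ≤ ⟪v, n⟫_ℝ) (a : HalfSpaceCluster d n) :
    (a.translate v hv).pts = fun i => a.pts i + v := rfl

/-- Translations by equal vectors agree (proof irrelevance). [folklore] -/
theorem translate_congr (a : HalfSpaceCluster d n) {v w : EuclideanSpace ℝ (Fin d)} (hv : 0 ≤ ⟪v, n⟫_ℝ)
    (hw : 0 ≤ ⟪w, n⟫_ℝ) (h : v = w) : a.translate v hv = a.translate w hw := by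
  subst h; rfl

/-- Translating by `0`. [folklore] -/
theorem translate_zero (a : HalfSpaceCluster d n) (h : 0 ≤ ⟪(0 : EuclideanSpace ℝ (Fin d)), n⟫_ℝ) :
    a.translate 0 h = a := by
  cases a; simp only [translate, add_zero]

/-- Translations compose additively. [folklore] -/
theorem translate_translate (a : HalfSpaceCluster d n) (v w : EuclideanSpace ℝ (Fin d))
    (hv : 0 ≤ ⟪v, n⟫_ℝ) (hw : 0 ≤ ⟪w, n⟫_ℝ) :
    (a.translate v hv).translate w hw =
      a.translate (w + v) (by rw [inner_add_left]; exact add_nonneg hw hv) := by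
  cases a; simp only [translate, add_assoc, add_comm v w]

/-- The shift vector `s n' + (t ∨ 0) n` has nonnegative normal component when `n' ⊥ n`. [folklore] -/
theorem inner_shiftVec_nonneg {n' : EuclideanSpace ℝ (Fin d)} (hn' : ⟪n', n⟫_ℝ = 0) (t s : ℝ) :
    0 ≤ ⟪s • n' + max t 0 • n, n⟫_ℝ := by
  rw [inner_add_left, real_inner_smul_left, real_inner_smul_left, hn', mul_zero, zero_add]
  exact mul_nonneg (le_max_right _ _) real_inner_self_nonneg

/-- **The two-parameter shift** of a cluster along a mirror direction `n' ⊥ n` and the normal: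
`shift n' t s a = a + s n' + (t ∨ 0) n` (time translation by `t ≥ 0` — the identity in `t` for
`t < 0`, junk convention — and spatial translation by `s`). [folklore] -/
def shift (n' : EuclideanSpace ℝ (Fin d)) (hn' : ⟪n', n⟫_ℝ = 0) (t s : ℝ) (a : HalfSpaceCluster d n) :
    HalfSpaceCluster d n :=
  a.translate (s • n' + max t 0 • n) (inner_shiftVec_nonneg hn' t s)

/-- The points of a shifted cluster. [folklore] -/
@[simp] theorem shift_pts (n' : EuclideanSpace ℝ (Fin d)) (hn' : ⟪n', n⟫_ℝ = 0) (t s : ℝ) (a : HalfSpaceCluster d n) :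
    (shift n' hn' t s a).pts = fun i => a.pts i + (s • n' + max t 0 • n) := rfl

/-- A shift keeps the number of points. [folklore] -/
@[simp] theorem shift_k (n' : EuclideanSpace ℝ (Fin d)) (hn' : ⟪n', n⟫_ℝ = 0) (t s : ℝ) (a : HalfSpaceCluster d n) :
    (shift n' hn' t s a).k = a.k := rfl

/-- `shift n' 0 0 = id`. [folklore] -/
theorem shift_zero_zero (n' : EuclideanSpace ℝ (Fin d)) (hn' : ⟪n', n⟫_ℝ = 0) (a : HalfSpaceCluster d n) :
    shift n' hn' 0 0 a = a := by
  rw [shift, translate_congr a _ (le_of_eq (by simp)) (by simp : (0 : ℝ) • n' + max (0 : ℝ) 0 • n = 0)]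
  exact a.translate_zero _

/-- Shifts at negative times are shifts at time `0`. [folklore] -/
theorem shift_of_neg (n' : EuclideanSpace ℝ (Fin d)) (hn' : ⟪n', n⟫_ℝ = 0) {t : ℝ} (ht : t ≤ 0) (s : ℝ)
    (a : HalfSpaceCluster d n) : shift n' hn' t s a = shift n' hn' 0 s a :=
  translate_congr a _ _ (by rw [max_eq_right ht, max_self])

/-- Shifts only depend on `t ∨ 0`. [folklore] -/
theorem shift_max (n' : EuclideanSpace ℝ (Fin d)) (hn' : ⟪n', n⟫_ℝ = 0) (t s : ℝ) (a : HalfSpaceCluster d n) :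
    shift n' hn' (max t 0) s a = shift n' hn' t s a :=
  translate_congr a _ _ (by rw [max_eq_left (le_max_right t 0)])

/-- **Shifts compose additively** for nonnegative times. [folklore] -/
theorem shift_shift (n' : EuclideanSpace ℝ (Fin d)) (hn' : ⟪n', n⟫_ℝ = 0) {t t' : ℝ} (ht : 0 ≤ t) (ht' : 0 ≤ t')
    (s s' : ℝ) (a : HalfSpaceCluster d n) :
    shift n' hn' t s (shift n' hn' t' s' a) = shift n' hn' (t + t') (s + s') a := by
  rw [shift, shift, shift, translate_translate]
  refine translate_congr a _ _ ?_
  rw [max_eq_left ht, max_eq_left ht', max_eq_left (add_nonneg ht ht'), add_smul, add_smul]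
  abel

end HalfSpaceCluster

/-! ### The mirror kernel of a correlation family -/

/-- **The OS kernel of `S` for the mirror `n^⊥`**: for half-space clusters `a = (x₁…x_k)`,
`b = (y₁…y_l)`, `K(a, b) = S_{k+l}(θ_n x₁, …, θ_n x_k, y₁, …, y_l)` (Glimm–Jaffe (6.1.9),
Osterwalder–Schrader (4.3), pointwise and for an arbitrary mirror). [folklore] -/
def mirrorKernel (S : CorrFamily d) (n : EuclideanSpace ℝ (Fin d)) (a b : HalfSpaceCluster d n) : ℝ :=
  S (a.k + b.k) (Fin.append (fun i => (ℝ ∙ n)ᗮ.reflection (a.pts i)) b.pts)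

section KernelGeometry

variable {S : CorrFamily d} {n : EuclideanSpace ℝ (Fin d)}

/-- **Symmetry of the mirror kernel** under `θ_n`-invariance and permutation symmetry of `S`:
`S(θa ⊔ b) = S(θ(θa ⊔ b)) = S(a ⊔ θb) = S(θb ⊔ a)`. [folklore] -/
theorem mirrorKernel_comm (hR : ∀ (N : ℕ) (x : Fin N → EuclideanSpace ℝ (Fin d)),
      S N (fun i => (ℝ ∙ n)ᗮ.reflection (x i)) = S N x)
    (hP : IsPermutationSymmetric S) (a b : HalfSpaceCluster d n) :
    mirrorKernel S n a b = mirrorKernel S n b a := by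
  unfold mirrorKernel
  rw [← hR (b.k + a.k), ← hP.comp_equiv (finBlockSwap b.k a.k)]
  congr 1
  rw [show (fun i => (ℝ ∙ n)ᗮ.reflection (Fin.append (fun i => (ℝ ∙ n)ᗮ.reflection (b.pts i)) a.pts i)) =
      (ℝ ∙ n)ᗮ.reflection ∘ Fin.append ((ℝ ∙ n)ᗮ.reflection ∘ b.pts) a.pts from rfl,
    comp_fin_append, fin_append_comp_finBlockSwap]
  congr 1
  funext i
  simp

/-- `θ_n (x + v) = θ_n x + v - 2 (⟪v,n⟫-part)`: for the normal, `θ_n (x + t n) = θ_n x - t n`. [folklore] -/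
theorem mirrorReflection_add_smul_normal (x : EuclideanSpace ℝ (Fin d)) (t : ℝ) :
    (ℝ ∙ n)ᗮ.reflection (x + t • n) = (ℝ ∙ n)ᗮ.reflection x - t • n := by
  rw [map_add, LinearIsometryEquiv.map_smul, mirrorReflection_normal, smul_neg, sub_eq_add_neg]

/-- For a mirror vector `v ⊥ n`, `θ_n (x + v) = θ_n x + v`. [folklore] -/
theorem mirrorReflection_add_orth (x : EuclideanSpace ℝ (Fin d)) {v : EuclideanSpace ℝ (Fin d)}
    (hv : ⟪v, n⟫_ℝ = 0) : (ℝ ∙ n)ᗮ.reflection (x + v) = (ℝ ∙ n)ᗮ.reflection x + v := by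
  rw [map_add, mirrorReflection_of_inner_eq_zero hv]

/-- **`K(a + t n, b) = K(a, b + t n)`** (`t ≥ 0`): `θ_n` turns the shift `+t n` of the reflected
block into `-t n`, and translation invariance moves it to the other block
(Osterwalder–Schrader (4.7)). [folklore] -/
theorem mirrorKernel_translate_normal (hT : IsTranslationInvariant S) {t : ℝ} (ht : 0 ≤ ⟪t • n, n⟫_ℝ)
    (a b : HalfSpaceCluster d n) :
    mirrorKernel S n (a.translate (t • n) ht) b = mirrorKernel S n a (b.translate (t • n) ht) := by
  unfold mirrorKernel
  simp only [HalfSpaceCluster.translate_k, HalfSpaceCluster.translate_pts, mirrorReflection_add_smul_normal]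
  rw [← hT (a.k + b.k) (-(t • n))
    (Fin.append (fun i => (ℝ ∙ n)ᗮ.reflection (a.pts i)) (fun i => b.pts i + t • n))]
  congr 1
  funext i
  refine Fin.addCases (fun j => ?_) (fun j => ?_) i
  · simp [sub_eq_add_neg]
  · simp

/-- **`K(a + v, b + v) = K(a, b)`** for `v ⊥ n` (`θ_n v = v` and translation invariance;
Osterwalder–Schrader (4.5)). [folklore] -/
theorem mirrorKernel_translate_orth (hT : IsTranslationInvariant S) {v : EuclideanSpace ℝ (Fin d)}
    (hv : ⟪v, n⟫_ℝ = 0) (hv' : 0 ≤ ⟪v, n⟫_ℝ) (a b : HalfSpaceCluster d n) :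
    mirrorKernel S n (a.translate v hv') (b.translate v hv') = mirrorKernel S n a b := by
  unfold mirrorKernel
  simp only [HalfSpaceCluster.translate_k, HalfSpaceCluster.translate_pts, mirrorReflection_add_orth _ hv]
  rw [← hT (a.k + b.k) v (Fin.append (fun i => (ℝ ∙ n)ᗮ.reflection (a.pts i)) b.pts)]
  congr 1
  funext i
  refine Fin.addCases (fun j => ?_) (fun j => ?_) i <;> simp

/-- **Kernel symmetry of the time shift**: `K(shift t 0 a, b) = K(a, shift t 0 b)`. [folklore] -/
theorem mirrorKernel_shift_time (hT : IsTranslationInvariant S) {n' : EuclideanSpace ℝ (Fin d)}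
    (hn' : ⟪n', n⟫_ℝ = 0) (t : ℝ) (a b : HalfSpaceCluster d n) :
    mirrorKernel S n (HalfSpaceCluster.shift n' hn' t 0 a) b =
      mirrorKernel S n a (HalfSpaceCluster.shift n' hn' t 0 b) := by
  have h0 : (0 : ℝ) • n' + max t 0 • n = max t 0 • n := by simp
  have hpos : 0 ≤ ⟪max t 0 • n, n⟫_ℝ := by
    rw [real_inner_smul_left]; exact mul_nonneg (le_max_right _ _) real_inner_self_nonneg
  rw [HalfSpaceCluster.shift, HalfSpaceCluster.shift, a.translate_congr _ hpos h0, b.translate_congr _ hpos h0]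
  exact mirrorKernel_translate_normal hT hpos a b

/-- **Kernel invariance of the spatial shift**: `K(shift 0 s a, shift 0 s b) = K(a, b)`. [folklore] -/
theorem mirrorKernel_shift_space (hT : IsTranslationInvariant S) {n' : EuclideanSpace ℝ (Fin d)}
    (hn' : ⟪n', n⟫_ℝ = 0) (s : ℝ) (a b : HalfSpaceCluster d n) :
    mirrorKernel S n (HalfSpaceCluster.shift n' hn' 0 s a) (HalfSpaceCluster.shift n' hn' 0 s b) =
      mirrorKernel S n a b := by
  have h0 : s • n' + max (0 : ℝ) 0 • n = s • n' := by simp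
  have horth : ⟪s • n', n⟫_ℝ = 0 := by rw [real_inner_smul_left, hn', mul_zero]
  rw [HalfSpaceCluster.shift, HalfSpaceCluster.shift, a.translate_congr _ horth.ge h0,
    b.translate_congr _ horth.ge h0]
  exact mirrorKernel_translate_orth hT horth horth.ge a b

/-- **The shifted kernel entry only depends on `(t ∨ 0, s' - s)`**:
`K(shift t s a, shift t' s' b) = K(a, shift (t ∨ 0 + t' ∨ 0) (s' - s) b)`. [folklore] -/
theorem mirrorKernel_shift_shift (hT : IsTranslationInvariant S) {n' : EuclideanSpace ℝ (Fin d)}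
    (hn' : ⟪n', n⟫_ℝ = 0) (t s t' s' : ℝ) (a b : HalfSpaceCluster d n) :
    mirrorKernel S n (HalfSpaceCluster.shift n' hn' t s a) (HalfSpaceCluster.shift n' hn' t' s' b) =
      mirrorKernel S n a (HalfSpaceCluster.shift n' hn' (max t 0 + max t' 0) (s' - s) b) := by
  have e1 : HalfSpaceCluster.shift n' hn' t s a =
      HalfSpaceCluster.shift n' hn' 0 s (HalfSpaceCluster.shift n' hn' (max t 0) 0 a) := by
    rw [HalfSpaceCluster.shift_shift n' hn' le_rfl (le_max_right _ _), zero_add, add_zero]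
    exact a.translate_congr _ _ (by rw [max_eq_left (le_max_right t 0)])
  have e2 : HalfSpaceCluster.shift n' hn' t' s' b =
      HalfSpaceCluster.shift n' hn' 0 s (HalfSpaceCluster.shift n' hn' (max t' 0) (s' - s) b) := by
    rw [HalfSpaceCluster.shift_shift n' hn' le_rfl (le_max_right _ _), zero_add, add_sub_cancel]
    exact b.translate_congr _ _ (by rw [max_eq_left (le_max_right t' 0)])
  rw [e1, e2, mirrorKernel_shift_space hT, mirrorKernel_shift_time hT,
    HalfSpaceCluster.shift_shift n' hn' (le_max_right _ _) (le_max_right _ _), zero_add]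

end KernelGeometry

/-! ### The OS data of a correlation family in the frame of a mirror -/

/-- **Osterwalder–Schrader data of a correlation family `S` in the frame of the mirror `n^⊥`**
(kernel level; Osterwalder–Schrader 1973 §4.1, Glimm–Jaffe 1987 Thm. 6.1.3 in pointwise form, for
an arbitrary hyperplane mirror): `n ≠ 0`; **reflection positivity** over finite families of
half-space clusters with real coefficients (repetitions and empty clusters allowed); invariance of
`S` under `θ_n` and under permutations (these make the kernel symmetric); translation invariance
(time shifts symmetric, spatial shifts isometric); and the two analytic inputs of the
reconstruction — kernel entries BOUNDED under time shifts (the substitute of the temperedness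
bound OS (4.8); it makes `e^{-tH}` a contraction) and jointly CONTINUOUS under the shifts along
`n` and any mirror direction `n' ⊥ n` (strong continuity). [folklore] -/
structure MirrorOSData (S : CorrFamily d) (n : EuclideanSpace ℝ (Fin d)) : Prop where
  /-- the normal is nonzero -/
  normal_ne_zero : n ≠ 0
  /-- reflection positivity in the mirror `n^⊥` over half-space clusters, real coefficients -/
  reflectionPositive : ∀ (m : ℕ) (k : Fin m → ℕ) (x : (a : Fin m) → Fin (k a) → EuclideanSpace ℝ (Fin d))
    (c : Fin m → ℝ), (∀ a i, 0 < ⟪x a i, n⟫_ℝ) →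
    0 ≤ ∑ a, ∑ b, c a * c b * S (k a + k b) (Fin.append (fun i => (ℝ ∙ n)ᗮ.reflection (x a i)) (x b))
  /-- `θ_n`-invariance of `S` -/
  reflectionInvariant : ∀ (N : ℕ) (x : Fin N → EuclideanSpace ℝ (Fin d)),
    S N (fun i => (ℝ ∙ n)ᗮ.reflection (x i)) = S N x
  /-- permutation symmetry (E3) -/
  symmetric : IsPermutationSymmetric S
  /-- translation invariance -/
  translationInvariant : IsTranslationInvariant S
  /-- kernel entries are bounded under time shifts of the second cluster -/
  kernel_bdd : ∀ a b : HalfSpaceCluster d n, ∃ C : ℝ, ∀ t : ℝ, 0 ≤ t →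
    ∀ h : 0 ≤ ⟪t • n, n⟫_ℝ, |mirrorKernel S n a (b.translate (t • n) h)| ≤ C
  /-- kernel entries are jointly continuous under the shifts along `n` and any `n' ⊥ n` -/
  kernel_cont : ∀ (n' : EuclideanSpace ℝ (Fin d)) (hn' : ⟪n', n⟫_ℝ = 0) (a b : HalfSpaceCluster d n),
    Continuous fun p : ℝ × ℝ => mirrorKernel S n a (HalfSpaceCluster.shift n' hn' p.1 p.2 b)

namespace MirrorOSData

variable {S : CorrFamily d} {n : EuclideanSpace ℝ (Fin d)} (h : MirrorOSData S n)
include h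

/-- The mirror kernel is symmetric. [folklore] -/
theorem mirrorKernel_comm (a b : HalfSpaceCluster d n) : mirrorKernel S n a b = mirrorKernel S n b a :=
  QuantumFieldTheory.mirrorKernel_comm h.reflectionInvariant h.symmetric a b

/-- **Reflection positivity over a finite set of clusters**: `Σ_{x,y ∈ s} a_x a_y K(x, y) ≥ 0` for
real `a`. [folklore] -/
theorem sum_sum_nonneg (s : Finset (HalfSpaceCluster d n)) (a : HalfSpaceCluster d n → ℝ) :
    0 ≤ ∑ x ∈ s, ∑ y ∈ s, a x * a y * mirrorKernel S n x y := by
  classical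
  set m := s.card
  set e : Fin m ≃ s := s.equivFin.symm
  have key := h.reflectionPositive m (fun i => (e i : HalfSpaceCluster d n).k)
    (fun i => (e i : HalfSpaceCluster d n).pts) (fun i => a (e i)) (fun i j => (e i : HalfSpaceCluster d n).pos j)
  convert key using 1
  rw [← Finset.sum_coe_sort s, ← e.sum_comp]
  refine Fintype.sum_congr _ _ fun i => ?_
  rw [← Finset.sum_coe_sort s, ← e.sum_comp]
  rfl

/-- **The complex Hermitian form is positive**: for a finitely supported complex functional `c`,
`Re Σ_{x,y} conj(c_x) c_y K(x, y) ≥ 0` (split `c = a + ib`; the cross terms cancel by symmetry of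
`K`, the rest is `Q(a) + Q(b) ≥ 0`). [folklore] -/
theorem re_sum_sum_conj_nonneg (c : HalfSpaceCluster d n →₀ ℂ) :
    0 ≤ (∑ x ∈ c.support, ∑ y ∈ c.support,
      conj (c x) * c y * ((mirrorKernel S n x y : ℝ) : ℂ)).re := by
  have hre : (∑ x ∈ c.support, ∑ y ∈ c.support, conj (c x) * c y * ((mirrorKernel S n x y : ℝ) : ℂ)).re =
      (∑ x ∈ c.support, ∑ y ∈ c.support, (c x).re * (c y).re * mirrorKernel S n x y) +
        ∑ x ∈ c.support, ∑ y ∈ c.support, (c x).im * (c y).im * mirrorKernel S n x y := by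
    rw [Complex.re_sum, ← Finset.sum_add_distrib]
    refine Finset.sum_congr rfl fun x _ => ?_
    rw [Complex.re_sum, ← Finset.sum_add_distrib]
    refine Finset.sum_congr rfl fun y _ => ?_
    simp only [Complex.mul_re, Complex.mul_im, Complex.conj_re, Complex.conj_im, Complex.ofReal_re,
      Complex.ofReal_im, mul_zero, sub_zero]
    ring
  rw [hre]
  exact add_nonneg (h.sum_sum_nonneg c.support fun x => (c x).re) (h.sum_sum_nonneg c.support fun x => (c x).im)

/-- Hermitian symmetry of the complexified kernel. [folklore] -/
theorem conj_mirrorKernel (x y : HalfSpaceCluster d n) :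
    conj ((mirrorKernel S n y x : ℝ) : ℂ) = ((mirrorKernel S n x y : ℝ) : ℂ) := by
  rw [Complex.conj_ofReal, h.mirrorKernel_comm y x]

end MirrorOSData

end Literature.MathematicalPhysics.QuantumFieldTheory
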